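import Summits.CriticalPhenomena.PercolationContinuityZ3.Theorems.Transplant.AutChartCriticalContinuity
import HarnessLib

/-!
# The open node `U_s` restated WITHOUT skeleton vocabulary: `SamePDropOfSkeletonFrmScaled₁` ⟺ Benjamini–Schramm continuity for subexponential graphs
# with a transitive group of automorphisms translating a chart `V → ℤ²` of rank two

builds on p205010 (kernel theorem, internal audit signed; external expert review pending) — nothing in this file uses p205010 and NOTHING is claimed about the OPEN node `SamePDropOfSkeletonFrmScaled₁`: the theorem is an
EQUIVALENCE between the node and a chart-free statement, proved from gen 25's `AutChart.criticalContinuity_of_autSubgroup` /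
`exists_oneType_skeleton_iff` and the tree's normal form `samePDropOfSkeletonFrmScaled₁_iff_continuity`.  Lane `prim-bschramm`, seat `prim-bschramm-p4` gen 25
(PART C3 of `P4-GENERAL.md` §47.9).  Helper file (`--supports stmt-CriticalPhenomena-4575 --as helper`).

`AutChart.frmScaledNode₁_iff_autChart : U_s ↔ ∀ G` connected, locally finite, countable, `¬HasExponentialGrowth G`, `∀ t`, (some `A ≤ Aut(G)` transitive translating a
chart `φ : V → ℤ²` with `det(φ x − φ t, φ y − φ t) ≠ 0` for some `x, y`) `→ θ_t(p_c) = 0`.  (⟹ gen 25's conditional theorem; ⟸ a one-type scaled skeleton carrier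
either grows exponentially — Hutchcroft — or has such an `(A, φ)`.)  So every conditional row of the C3 class map rests on EXACTLY "Conj. 4 for subexponential
graphs with a transitive `ℤ²`-equivariant chart".
[cite: BenjaminiSchramm1996, Conj. 4] [cite: Hutchcroft2016, Thm. 1.1] [cite: KozmaNitzan2024, §4 p. 16 (Lemma 8)]
-/

noncomputable section

namespace Summit.CriticalPhenomena.PercolationContinuityZ3.Theorems.Transplant

open SimpleGraph Filter Literature.Barriers.CriticalPhenomena Literature.Probability.LatticeModels Literature.Probability.Percolation
open scoped Classical

namespace AutChart

/-! ## The open node restated WITHOUT skeleton vocabulary -/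

/-- **NORMAL FORM OF THE OPEN NODE `U_s` IN AUTOMORPHISM-GROUP LANGUAGE**: `SamePDropOfSkeletonFrmScaled₁` is EQUIVALENT to Benjamini–Schramm continuity
(`θ_t(p_c) = 0`) for every connected, locally finite, countable graph WITHOUT exponential growth carrying a chart `V → ℤ²` of rank-two values translated by a
TRANSITIVE subgroup of `Aut(G)` (⟹: `criticalContinuity_of_autSubgroup`; ⟸: a one-type `PlanarSkeletonFrmScaled` carrier either grows exponentially —
Hutchcroft — or is such a graph, `exists_oneType_skeleton_iff`; then the tree's normal form `samePDropOfSkeletonFrmScaled₁_iff_continuity`).  So the one node on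
which every conditional row of the C3 class map rests is EXACTLY "Conj. 4 for subexponential graphs with a transitive ℤ²-equivariant chart".
[cite: BenjaminiSchramm1996, Conj. 4] [cite: Hutchcroft2016, Thm. 1.1] [cite: KozmaNitzan2024, §4 p. 16 (Lemma 8)] -/
theorem frmScaledNode₁_iff_autChart : SamePDropOfSkeletonFrmScaled₁ ↔
    ∀ {V : Type} [DecidableEq V] [Countable V] (G : SimpleGraph V) [G.LocallyFinite], G.Connected → ¬ HasExponentialGrowth G → ∀ t : V,
      (∃ (A : Subgroup (G ≃g G)) (φ : V → Site 2), (∀ v : V, ∃ α ∈ A, α t = v) ∧ (∀ α ∈ A, ∀ w : V, φ (α w) = φ w + (φ (α t) - φ t)) ∧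
        ∃ x y : V, MaxArea.det2 (φ x - φ t) (φ y - φ t) ≠ 0) → theta G t (criticalProbIOf G t) = 0 := by
  constructor
  · intro hN V _ _ G _ hc _ t hA
    obtain ⟨A, φ, htr, hφ, hrank⟩ := hA
    exact criticalContinuity_of_autSubgroup hN hc t A htr φ hφ hrank t
  · intro hK
    refine samePDropOfSkeletonFrmScaled₁_iff_continuity.2 ?_
    intro V _ _ G _ Φ hc t ht h1
    by_cases hG : HasExponentialGrowth G
    · exact Hutchcroft2016_noPercolationAtCriticality_holds G hc Φ.isQuasiTransitive_frmScaled hG t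
    · exact hK G hc hG t ((exists_oneType_skeleton_iff hG hc t).1 ⟨Φ, h1⟩)

end AutChart

end Summit.CriticalPhenomena.PercolationContinuityZ3.Theorems.Transplant

end
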